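import Summits.ResolutionOfSingularities.ResolutionOfSingularities.Theorems.PurelyInseparableDim4ResConeCInfGameStep
import HarnessLib
import HarnessLib.Audit.Tags

/-!
# Purely inseparable four-folds — the C∞ GAME STEP FOR EVERY PRIME: one pure corner step of the light-pair power cone at
# `(p, p − 1)` in res-dim4-p-9's p-free game coordinates (dictionary, corner map, forward / backward laws, exact ledger
# transport) (cell `res-dim4-pi`, K2(p) lane, rung-1 power-cone line «light pair of TAIL(p, p−1, 3) ∀ p», FILE 2)

[OURS · counted 0 · cell `res-dim4-pi` · K2(p) lane (holder res-dim4-p-12 g5, ruling g5-2 (6): the line is booked, one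
p-generic file at a time); the `(5, 4)` instance is res-dim4-p-2 g4's `…ResConeCInfGameStep` (K24b-FRAME F2a); seat
res-dim4-p-3 g5.]  Nothing here proves K2(p) for any `p`, any TAIL(p, p−1, 3), `NoIsolatedTrap p p`, the Cossart–Jannsen–Saito
theorem or resolution of singularities in dimension ≥ 4 / characteristic `p` — NOT proved.  AI kernel work, weaker than
expert review.  This line kills only the LIGHT sub-row of the power-cone slots B1 (exit table), and not by itself.

DICTIONARY (fixed letters; `j` = chart letter and `i` = the other slot, `{j, i} = {λ, μ}`; free `u`, contact `f`;
`d + 1 = p`, ledger `r = x_j x_i`, order `d + 2 = p + 1`): the game monomial `(c, a, b, e)` (ANY `c ≤ d − 1`) is the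
`F`-exponent `E(c,a,b,e) = (a+2)·j + (b+2)·i + e·u + (d−1−c)·f` (degree `a + b + e + d + 3 − c`).  For ONE pure corner step
`s′ = CentreBlowup.step p univ j 0 s`:
* §1 `gameExp_degree_prime`, **`chartExponent_gameExp_prime`** — Hironaka's corner map IS the game's rule
  `(c,a,b,e) ↦ (c, a+b+e−c, b, e)` for every prime (the `p` cancels), `dead_of_isPthPowerExponent_gameExp_prime` — the
  cleaning deletes DEAD monomials only (`c ≤ a + e ∧ c ≤ b + e`).
* §2 **`coeff_step_zero_gameExp_prime`** (FORWARD law, exact), `le_of_coeff_gameExp_ne_zero_prime` (no truncation on a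
  straight state), `coeff_step_zero_gameExp_ne_zero_prime`, **`exists_parent_of_coeff_step_zero_gameExp_prime`** (BACKWARD
  law with the ledger exception), `exists_parent_of_coeff_step_zero_gameExp_of_ledger_prime` (EXACT ledger: every parent
  monomial of `f`-degree `≤ d − 1` has `j`-exponent `≥ 2` ⇒ a game parent exists).
* §3 `degree_le_degree_chartExponent_add_prime`, **`ledger_step_zero_prime`** — EXACT ledger transport: «`f`-degree
  `≤ d − 1` ⇒ divisible by `x_j² x_i²`» passes from a parent whose such monomials have degree `≥ d + 3` to the child.
The jet-truncated (`< N`) variants of F2a are NOT ported (the pure-corner line needs exact ledgers only; a transport half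
would add them).
[cite: CossartJannsenSaito2020, Lemma 13.2, Thm. 3.14] [cite: Hauser2010, §§F–G]
bears_on: LADDER-RESOLUTION:D157-DOOR2 (res-dim4-pi · K2(p) · power cones · C∞ game step every prime).  Supports
stmt-ResolutionOfSingularities-16155 (helper).
-/

set_option linter.dupNamespace false -- mandated namespace of this single-conjunct summit

noncomputable section

namespace Summit.ResolutionOfSingularities.ResolutionOfSingularities.Theorems.PIDim4

namespace ResCone

open MvPolynomial Finset
open Literature.AlgebraicGeometry.Resolution
open Literature.AlgebraicGeometry.Resolution.CentreBlowup
open Literature.AlgebraicGeometry.Resolution.Hauser2010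
open Literature.AlgebraicGeometry.Resolution.HauserPerlega2019

variable {K : Type} [Field K]

/-! ## 1. The game exponent `E(c,a,b,e) = (a+2)·j + (b+2)·i + e·u + (d−1−c)·f` and Hironaka's corner map, every prime -/

section GameExp

variable {j i u f : Fin 4} (hji : j ≠ i) (hju : j ≠ u) (hjf : j ≠ f) (hiu : i ≠ u) (hif : i ≠ f) (huf : u ≠ f)
include hji hju hjf hiu hif huf

omit hji hju hjf hiu hif huf in
/-- Degree of the game exponent: `|E(c,a,b,e)| = a + b + e + d + 3 − c` (`c + 1 ≤ d`). [OURS · bookkeeping] -/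
theorem gameExp_degree_prime {d c : ℕ} (hc : c + 1 ≤ d) (a b e : ℕ) :
    (Finsupp.single j (a + 2) + Finsupp.single i (b + 2) + Finsupp.single u e + Finsupp.single f (d - 1 - c) :
      Fin 4 →₀ ℕ).degree = a + b + e + d + 3 - c := by
  rw [degree_quad j i u f]; omega

/-- **The corner map in game coordinates, every prime**: in the chart of the letter `j` (`d + 1 = p`), the exponent
`E(c,a,b,e)` goes to `E(c, a+b+e−c, b, e)` — p-9's λ-rule, with NO truncation as soon as `c ≤ a + b + e`; the prime
cancels. [OURS] [cite: CossartJannsenSaito2020, Lemma 13.2] -/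
theorem chartExponent_gameExp_prime (p : ℕ) {d : ℕ} (hdp : d + 1 = p) {c : ℕ} (hc : c + 1 ≤ d) {a b e : ℕ}
    (hle : c ≤ a + b + e) :
    chartExponent p Finset.univ j
        (Finsupp.single j (a + 2) + Finsupp.single i (b + 2) + Finsupp.single u e + Finsupp.single f (d - 1 - c)) =
      Finsupp.single j (a + b + e - c + 2) + Finsupp.single i (b + 2) + Finsupp.single u e +
        Finsupp.single f (d - 1 - c) := by
  obtain ⟨h1, h2, h3, h4⟩ := quad_apply hji hju hjf hiu hif huf (a + 2) (b + 2) e (d - 1 - c)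
  obtain ⟨h1', h2', h3', h4'⟩ := quad_apply hji hju hjf hiu hif huf (a + b + e - c + 2) (b + 2) e (d - 1 - c)
  ext k
  rcases letters_exhaust hji hju hjf hiu hif huf k with h | h | h | h <;> rw [h]
  · rw [chartExponent_univ_apply_self, gameExp_degree_prime (j := j) (i := i) (u := u) (f := f) hc, h1']; omega
  · rw [chartExponent_apply_of_ne p Finset.univ hji.symm, h2, h2']
  · rw [chartExponent_apply_of_ne p Finset.univ hju.symm, h3, h3']
  · rw [chartExponent_apply_of_ne p Finset.univ hjf.symm, h4, h4']

/-- **Cleaning touches DEAD monomials only, every prime**: a game exponent all of whose entries are multiples of `p` has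
`c = d − 1 = p − 2` and `a, b ≥ p − 2`, so it is dead (`c ≤ a + e ∧ c ≤ b + e`). [OURS] -/
theorem dead_of_isPthPowerExponent_gameExp_prime (p : ℕ) {d : ℕ} (hdp : d + 1 = p) {c : ℕ} (hc : c + 1 ≤ d)
    {a b e : ℕ}
    (h : IsPthPowerExponent p
      (Finsupp.single j (a + 2) + Finsupp.single i (b + 2) + Finsupp.single u e + Finsupp.single f (d - 1 - c) :
        Fin 4 →₀ ℕ)) : c ≤ a + e ∧ c ≤ b + e := by
  obtain ⟨h1, h2, h3, h4⟩ := quad_apply hji hju hjf hiu hif huf (a + 2) (b + 2) e (d - 1 - c)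
  unfold IsPthPowerExponent at h
  have hj' := h j (by rw [Finsupp.mem_support_iff, h1]; omega)
  have hi' := h i (by rw [Finsupp.mem_support_iff, h2]; omega)
  rw [h1] at hj'
  rw [h2] at hi'
  have hja : p ≤ a + 2 := Nat.le_of_dvd (by omega) hj'
  have hib : p ≤ b + 2 := Nat.le_of_dvd (by omega) hi'
  by_cases hcd : c + 1 = d
  · constructor <;> omega
  · have hf' := h f (by rw [Finsupp.mem_support_iff, h4]; omega)
    rw [h4] at hf'
    have := Nat.le_of_dvd (by omega) hf'
    omega

end GameExp

/-! ## 2. One pure corner step: the forward and backward laws in game coordinates, every prime -/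

section Step

variable [DecidableEq K]
variable {j i u f : Fin 4} (hji : j ≠ i) (hju : j ≠ u) (hjf : j ≠ f) (hiu : i ≠ u) (hif : i ≠ f) (huf : u ≠ f)
include hji hju hjf hiu hif huf

/-- **FORWARD LAW, every prime** (p-9's `hfwdL`, exact transport, any degree): at a pure corner step in the chart of `j`,
the coefficient of the LIVE image `E(c, a+b+e−c, b, e)` in the child equals the coefficient of `E(c,a,b,e)` in the parent.
[OURS] [cite: Hauser2010, §§F–G] -/
theorem coeff_step_zero_gameExp_prime (p : ℕ) {d : ℕ} (hdp : d + 1 = p) (s : State K)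
    (hq : ((p : ℕ) : ℕ∞) ≤ ordAlong Finset.univ s.F) {c : ℕ} (hc : c + 1 ≤ d) {a b e : ℕ} (hle : c ≤ a + b + e)
    (hlive : ¬ (c ≤ (a + b + e - c) + e ∧ c ≤ b + e)) :
    coeff (Finsupp.single j (a + b + e - c + 2) + Finsupp.single i (b + 2) + Finsupp.single u e +
        Finsupp.single f (d - 1 - c)) (CentreBlowup.step p Finset.univ j 0 s).F =
      coeff (Finsupp.single j (a + 2) + Finsupp.single i (b + 2) + Finsupp.single u e + Finsupp.single f (d - 1 - c))
        s.F := by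
  have he : p ≤ (Finsupp.single j (a + 2) + Finsupp.single i (b + 2) + Finsupp.single u e +
      Finsupp.single f (d - 1 - c) : Fin 4 →₀ ℕ).degree := by
    rw [gameExp_degree_prime (j := j) (i := i) (u := u) (f := f) hc]; omega
  rw [← chartExponent_gameExp_prime hji hju hjf hiu hif huf p hdp hc hle, coeff_step_zero_chartExponent p j s hq he,
    if_neg]
  intro hp
  rw [chartExponent_gameExp_prime hji hju hjf hiu hif huf p hdp hc hle] at hp
  exact hlive (dead_of_isPthPowerExponent_gameExp_prime hji hju hjf hiu hif huf p hdp hc hp)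

omit [DecidableEq K] in
/-- A PRESENT game monomial of a state of order `≥ d + 2` whose only degree-`(d + 2)` monomials have `f`-exponent `d`
(straight C∞ initial monomial `x^r f^d`) satisfies `c ≤ a + b + e` (no truncation in the corner map). [OURS] -/
theorem le_of_coeff_gameExp_ne_zero_prime {d : ℕ} (s : State K) (h6 : ∀ e ∈ s.F.support, d + 2 ≤ e.degree)
    (hstraight : ∀ e ∈ s.F.support, e.degree = d + 2 → e f = d) {c : ℕ} (hc : c + 1 ≤ d) {a b e : ℕ}
    (h : coeff (Finsupp.single j (a + 2) + Finsupp.single i (b + 2) + Finsupp.single u e +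
      Finsupp.single f (d - 1 - c)) s.F ≠ 0) : c ≤ a + b + e := by
  have hmem := mem_support_iff.mpr h
  have hdeg := h6 _ hmem
  rw [gameExp_degree_prime (j := j) (i := i) (u := u) (f := f) hc] at hdeg
  by_contra hlt
  have hdeg6 : (Finsupp.single j (a + 2) + Finsupp.single i (b + 2) + Finsupp.single u e +
      Finsupp.single f (d - 1 - c) : Fin 4 →₀ ℕ).degree = d + 2 := by
    rw [gameExp_degree_prime (j := j) (i := i) (u := u) (f := f) hc]; omega
  have hf4 := hstraight _ hmem hdeg6
  rw [(quad_apply hji hju hjf hiu hif huf (a + 2) (b + 2) e (d - 1 - c)).2.2.2] at hf4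
  omega

/-- **FORWARD LAW for present monomials, every prime**: a present game monomial of a straight state with live image has
its image present at the child. [OURS] -/
theorem coeff_step_zero_gameExp_ne_zero_prime (p : ℕ) {d : ℕ} (hdp : d + 1 = p) (s : State K)
    (hq : ((p : ℕ) : ℕ∞) ≤ ordAlong Finset.univ s.F) (h6 : ∀ e ∈ s.F.support, d + 2 ≤ e.degree)
    (hstraight : ∀ e ∈ s.F.support, e.degree = d + 2 → e f = d) {c : ℕ} (hc : c + 1 ≤ d) {a b e : ℕ}
    (h : coeff (Finsupp.single j (a + 2) + Finsupp.single i (b + 2) + Finsupp.single u e +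
      Finsupp.single f (d - 1 - c)) s.F ≠ 0) (hlive : ¬ (c ≤ (a + b + e - c) + e ∧ c ≤ b + e)) :
    coeff (Finsupp.single j (a + b + e - c + 2) + Finsupp.single i (b + 2) + Finsupp.single u e +
        Finsupp.single f (d - 1 - c)) (CentreBlowup.step p Finset.univ j 0 s).F ≠ 0 := by
  rw [coeff_step_zero_gameExp_prime hji hju hjf hiu hif huf p hdp s hq hc
    (le_of_coeff_gameExp_ne_zero_prime hji hju hjf hiu hif huf s h6 hstraight hc h) hlive]
  exact h

/-- **BACKWARD LAW, every prime** (p-9's `hevol`, live branch, with the ledger exception explicit): a game monomial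
`E(c, a′, b, e)` present at the pure-corner child in the chart of `j` is the image of a parent monomial with the same
`(c, b, e)`: either a game monomial `E(c, a₀, b, e)` with `a′ + c = a₀ + b + e`, or the LEDGER EXCEPTION — a parent monomial
with `j`-exponent `1`, `f`-degree `d − 1 − c`, and `a′ + 1 + c = b + e`. [OURS] [cite: CossartJannsenSaito2020, Lemma 13.2] -/
theorem exists_parent_of_coeff_step_zero_gameExp_prime (p : ℕ) {d : ℕ} (hdp : d + 1 = p) (s : State K)
    (hr1 : ∀ e ∈ s.F.support, 1 ≤ e j) {c : ℕ} (hc : c + 1 ≤ d) {a' b e : ℕ}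
    (h : coeff (Finsupp.single j (a' + 2) + Finsupp.single i (b + 2) + Finsupp.single u e +
      Finsupp.single f (d - 1 - c)) (CentreBlowup.step p Finset.univ j 0 s).F ≠ 0) :
    (∃ a₀, coeff (Finsupp.single j (a₀ + 2) + Finsupp.single i (b + 2) + Finsupp.single u e +
        Finsupp.single f (d - 1 - c)) s.F ≠ 0 ∧ a' + c = a₀ + b + e) ∨
      (coeff (Finsupp.single j 1 + Finsupp.single i (b + 2) + Finsupp.single u e + Finsupp.single f (d - 1 - c))
          s.F ≠ 0 ∧ a' + 1 + c = b + e) := by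
  obtain ⟨m, hm, hmE⟩ := exists_of_mem_support_step_zero j s (mem_support_iff.mpr h)
  obtain ⟨h1, h2, h3, h4⟩ := quad_apply hji hju hjf hiu hif huf (a' + 2) (b + 2) e (d - 1 - c)
  have hmi : m i = b + 2 := by rw [← chartExponent_apply_of_ne p Finset.univ hji.symm m, hmE, h2]
  have hmu : m u = e := by rw [← chartExponent_apply_of_ne p Finset.univ hju.symm m, hmE, h3]
  have hmf : m f = d - 1 - c := by rw [← chartExponent_apply_of_ne p Finset.univ hjf.symm m, hmE, h4]
  have hmj : m.degree - p = a' + 2 := by rw [← chartExponent_univ_apply_self p j m, hmE, h1]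
  have hdeg := degree_eq_quad hji hju hjf hiu hif huf m
  rw [hmi, hmu, hmf] at hdeg
  have hm1 := hr1 m hm
  have hmq := eq_sum_single_four hji hju hjf hiu hif huf m
  rw [hmi, hmu, hmf] at hmq
  by_cases hj2 : 2 ≤ m j
  · refine Or.inl ⟨m j - 2, ?_, by omega⟩
    rw [show m j - 2 + 2 = m j by omega, ← hmq]
    exact mem_support_iff.mp hm
  · have hj1 : m j = 1 := by omega
    refine Or.inr ⟨?_, by omega⟩
    rw [hj1] at hmq
    rw [← hmq]
    exact mem_support_iff.mp hm

/-- **BACKWARD LAW under the EXACT ledger reading, every prime**: if every parent monomial of `f`-degree `≤ d − 1` has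
`j`-exponent `≥ 2` (the pair-ledger divisibility of a straight frame), then a child game monomial `E(c, a′, b, e)` has a
GAME parent `E(c, a₀, b, e)` with `a′ + c = a₀ + b + e`. [OURS] -/
theorem exists_parent_of_coeff_step_zero_gameExp_of_ledger_prime (p : ℕ) {d : ℕ} (hdp : d + 1 = p) (s : State K)
    (hr1 : ∀ e ∈ s.F.support, 1 ≤ e j) (hled : ∀ e ∈ s.F.support, e f ≤ d - 1 → 2 ≤ e j) {c : ℕ} (hc : c + 1 ≤ d)
    {a' b e : ℕ}
    (h : coeff (Finsupp.single j (a' + 2) + Finsupp.single i (b + 2) + Finsupp.single u e +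
      Finsupp.single f (d - 1 - c)) (CentreBlowup.step p Finset.univ j 0 s).F ≠ 0) :
    ∃ a₀, coeff (Finsupp.single j (a₀ + 2) + Finsupp.single i (b + 2) + Finsupp.single u e +
        Finsupp.single f (d - 1 - c)) s.F ≠ 0 ∧ a' + c = a₀ + b + e := by
  rcases exists_parent_of_coeff_step_zero_gameExp_prime hji hju hjf hiu hif huf p hdp s hr1 hc h with h' | ⟨h', -⟩
  · exact h'
  · exfalso
    obtain ⟨h1, -, -, h4⟩ := quad_apply hji hju hjf hiu hif huf 1 (b + 2) e (d - 1 - c)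
    have hmem := mem_support_iff.mpr h'
    have h2j := hled _ hmem (by rw [h4]; omega)
    rw [h1] at h2j
    omega

/-! ## 3. Exact transport of the ledger reading through a pure corner step, every prime -/

/-- Degree bookkeeping of the corner map, every prime: a child monomial has degree at least its parent's degree minus
`d = p − 1` (the kept slot `i` has exponent `≥ 1`). [OURS · bookkeeping] -/
theorem degree_le_degree_chartExponent_add_prime (p : ℕ) {d : ℕ} (hdp : d + 1 = p) {m : Fin 4 →₀ ℕ}
    (hp : p ≤ m.degree) (hi1 : 1 ≤ m i) :
    m.degree ≤ (chartExponent p Finset.univ j m).degree + d := by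
  have hdeg := degree_eq_quad hji hju hjf hiu hif huf m
  have hdeg' := degree_eq_quad hji hju hjf hiu hif huf (chartExponent p Finset.univ j m)
  rw [chartExponent_univ_apply_self, chartExponent_apply_of_ne p Finset.univ hji.symm,
    chartExponent_apply_of_ne p Finset.univ hju.symm, chartExponent_apply_of_ne p Finset.univ hjf.symm] at hdeg'
  omega

omit hju hiu hif huf in
/-- **EXACT LEDGER TRANSPORT, every prime**: if every parent monomial of `f`-degree `≤ d − 1` is divisible by `x_j² x_i²`
(in `F`-coordinates) and has degree `≥ d + 3` (the straight initial monomial `x^r f^d` is the only one of degree `d + 2`),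
then the divisibility holds at the pure-corner child in the chart of `j` (the degree reading there comes from the child's
own straightness, F3 (i)). [OURS] -/
theorem ledger_step_zero_prime (p : ℕ) {d : ℕ} (hdp : d + 1 = p) (s : State K)
    (h7 : ∀ e ∈ s.F.support, e f ≤ d - 1 → d + 3 ≤ e.degree)
    (hled : ∀ e ∈ s.F.support, e f ≤ d - 1 → 2 ≤ e j ∧ 2 ≤ e i) :
    ∀ e' ∈ (CentreBlowup.step p Finset.univ j 0 s).F.support, e' f ≤ d - 1 → 2 ≤ e' j ∧ 2 ≤ e' i := by
  intro e' he' hf'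
  obtain ⟨m, hm, hmE⟩ := exists_of_mem_support_step_zero j s he'
  subst hmE
  rw [chartExponent_apply_of_ne p Finset.univ hjf.symm] at hf'
  have hdeg7 := h7 m hm hf'
  have h2 := hled m hm hf'
  rw [chartExponent_univ_apply_self, chartExponent_apply_of_ne p Finset.univ hji.symm]
  exact ⟨by omega, h2.2⟩

end Step

end ResCone

end Summit.ResolutionOfSingularities.ResolutionOfSingularities.Theorems.PIDim4

end
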